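import Summits.QuantumFields.BalabanUV.T4Continuum.Support.RegionGaugeColumnsTower
import Summits.QuantumFields.BalabanUV.T4Continuum.Support.RegionLocalPairingCrude
import Summits.QuantumFields.BalabanUV.T4Continuum.Support.RegionStarGradientLinearBox
import Summits.QuantumFields.BalabanUV.T4Continuum.Support.DirichletScalarTowerLevels

/-!
# T⁴ programme, spine node NE2 (U1a), sub-row Δ1 «NE2⁰-Dirichlet» — THE BOX STAR TOWERS OF THE FAITHFUL `Δ_a(Ω₀)` AT RATE `(√L)⁻¹`
# MODULO ONE SOCKET: the Gaffney pairing (P-W) of the local operator for the rungs `1 ≤ k` (rung `0` spliced in)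

NE2 formalisation swarm `b2b-balaban-t4-ne2-formalise-*`, LEAF PROVER 06 (gen 7), junction holder (owner R40 (b), journal 2026-08-20
l.23184), file 3a of «Δ1-VEC-BT-TRACE».  Composition of three landed ENDs BY NAME: leaf-05-g9's B4a
`RegionGaugeColumnsTower.hinjK_box_of_WPairing` / `towerLimitRate_star_renorm_box_of_WPairing` (= this seat's END of record p240493 with
leaf (B) discharged: the renormalised box star tower modulo the (P-W) triple `hεW`, `hrate`, `hPW` at every rung `k`), the owner's O15-g
`RegionLocalPairingCrude.hPW_of_succ` / `hPW_rate_of_succ` (rung `0`: `lev L 0 = 1`, crude bound `2(1+a)`; the splice), and gen 6's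
`RegionStarGradientLinearBox.towerLimitRate_star_box_of_compressed` (the compressed twin from `hinjK`).  RESULT — at the tower's own rate
`θ = (√L)⁻¹` and with ONE displayed socket, the rung-`≥ 1` Gaffney pairing in the owner's `Ebud` currency

  `hPW1 : ∀ k u v, 1 ≤ k → ‖⟨v, (JpR k·Δ_loc(k,0) − Δ_loc(k+1,0)·JpR k) u⟩‖ ≤ ε k·√(Ebud_k u)·√(Ebud_{k+1} v)`, `0 ≤ ε k ≤ C_P·((√L)⁻¹)^k` (`1 ≤ k`)

(leaf-03-g8's P5 + leaf-01-g10's P4; exactly what remains of the owner's cut (L) ∧ (B) ∧ (Bᵗ) ∧ (K) on coordinate boxes):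
 * **`hinjK_box_of_WPairing1`** — King's compressed injected law of the faithful `Δ_a(Ω₀)` on every coordinate box, `≤ CinjP·((√L)⁻¹)^k`;
 * **`towerLimitRate_star_renorm_box_of_WPairing1`** — the renormalised box star tower converges at rate `(√L)⁻¹`;
 * **`towerLimitRate_star_box_of_WPairing1`** — the compressed (King) box star tower converges at rate `(√L)⁻¹`.
File 3 (no displayed binder) = these three with `hPW1 :=` P5's theorem.

HONEST FRAMING (T4-DAG p. 1).  Bookkeeping over landed modules ([folklore]); model level (`U = 1`, ONE region = a coordinate box of unit
blocks, ONE averaging scale, finite torus, linear layer, operator norm); the rung-`≥ 1` Gaffney pairing is DISPLAYED, not proved; `hinjK` / W3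
on boxes OPEN until it lands; general unions OPEN; NE2 (U1a) NOT proved; spine PROVED 0/9 unchanged; NOT [B9] (3.16)/(3.23)–(3.27)/(3.42)
as printed; NOT infinite volume / mass gap / Clay.  HONEST DEPENDENCY: continuum YM on T⁴ ⇐ BetaPertH ∧ nine spine estimates (0/9 proved);
BetaPertH ⇐ (D1) ∧ (D4) ∧ CAP+tail; G-an2-4 gates asym, D1 and NE2/3/4.  No `sorry`.
-/

noncomputable section

open scoped BigOperators ComplexConjugate Matrix Matrix.Norms.L2Operator

namespace Summit.QuantumFields.BalabanUV.T4Continuum.RegionBoxStarTowerSocket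

open Literature.MathematicalPhysics.QuantumFieldTheory.Balaban1983to89.B5Prop11Plancherel (Tor fine)
open Literature.MathematicalPhysics.QuantumFieldTheory.Balaban1983to89.B5Prop11Lower (nsq)
open Literature.MathematicalPhysics.QuantumFieldTheory.Balaban1983to89.B5G183RateUnitTower (lev)
open Summit.QuantumFields.BalabanUV.T4Continuum
open Summit.QuantumFields.BalabanUV.T4Continuum.CovariantAveragingTower (TowerLimitRate)
open Summit.QuantumFields.BalabanUV.T4Continuum.BackgroundResolventTower (Cpert)
open Summit.QuantumFields.BalabanUV.T4Continuum.RegionGaugeFixedVector (starReg regionDeltaA)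
open Summit.QuantumFields.BalabanUV.T4Continuum.DirichletSubregionTowerOf (pidx JpR QpR)
open Summit.QuantumFields.BalabanUV.T4Continuum.DirichletSubregionRenormTower (AnR)
open Summit.QuantumFields.BalabanUV.T4Continuum.DirichletStarVectorTower (starP gamStar)
open Summit.QuantumFields.BalabanUV.T4Continuum.RegionInteriorW2 (CgIbox)
open Summit.QuantumFields.BalabanUV.T4Continuum.RegionSliceCoerciveBoxTower (cW1box)
open Summit.QuantumFields.BalabanUV.T4Continuum.RegionGaugeResolventSplit (regionDeltaLoc)
open Summit.QuantumFields.BalabanUV.T4Continuum.RegionGaugeResolventTower (C1loc)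
open Summit.QuantumFields.BalabanUV.T4Continuum.RegionLocalInjectedAssembly (Ebud ClW CKbox)
open Summit.QuantumFields.BalabanUV.T4Continuum.RegionLocalBudgets (CHbox)
open Summit.QuantumFields.BalabanUV.T4Continuum.RegionGaugeColumnsTrace (Cbt)
open Summit.QuantumFields.BalabanUV.T4Continuum.RegionGaugeColumnsTower (CbBox hinjK_box_of_WPairing towerLimitRate_star_renorm_box_of_WPairing)
open Summit.QuantumFields.BalabanUV.T4Continuum.RegionLocalPairingCrude (hPW_of_succ hPW_rate_of_succ)
open Summit.QuantumFields.BalabanUV.T4Continuum.RegionStarGradientLinearBox (CgLin0 CgLin1 towerLimitRate_star_box_of_compressed)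
open Summit.QuantumFields.BalabanUV.T4Continuum.DirichletScalarTowerLevels (inv_sqrt_lt_one)
open Summit.QuantumFields.BalabanUV.Beta.GAN24.DirichletBoxTwoLevel (IsCoordBox)

variable {d : ℕ} (L : ℕ) [NeZero L] (M : Fin d → ℕ) [hM : ∀ μ, NeZero (M μ)] (S : Tor M → Prop) [DecidablePred S] (a a' : ℝ)

/-- the constant of the compressed injected law on boxes given the rung-`≥ 1` pairing constant `C_P` (rung `0` spliced at `2(1+a)`).
[folklore] -/
def CinjP (d L : ℕ) (a a' CP : ℝ) : ℝ :=
  C1loc d a a' (ClW d a a' (max (2 * (1 + a)) CP) (CHbox d a a')) (CbBox d L a') (Cbt d L a' (CbBox d L a')) (CKbox d L a')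

/-- THE SPLICED (P-W) TRIPLE at `θ = (√L)⁻¹` from the rung-`≥ 1` pairing (the owner's O15-g `hPW_of_succ` / `hPW_rate_of_succ`). [folklore] -/
theorem hPW_splice (ha : 0 < a) {ε : ℕ → ℝ} {CP : ℝ} (hε1 : ∀ k, 1 ≤ k → 0 ≤ ε k)
    (hrate1 : ∀ k, 1 ≤ k → ε k ≤ CP * ((Real.sqrt L)⁻¹) ^ k)
    (hPW1 : ∀ (k : ℕ) (u : pidx L M (starP L M S) k → ℂ) (v : pidx L M (starP L M S) (k + 1) → ℂ), 1 ≤ k →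
      ‖star v ⬝ᵥ ((JpR L M (starP L M S) k * regionDeltaLoc (lev L k) M 0 S
          - regionDeltaLoc (lev L (k + 1)) M 0 S * JpR L M (starP L M S) k) *ᵥ u)‖
        ≤ ε k * Real.sqrt (Ebud (lev L k) M a S u) * Real.sqrt (Ebud (lev L (k + 1)) M a S v)) :
    (∀ k, 0 ≤ (if k = 0 then 2 * (1 + a) else ε k))
    ∧ (∀ k, (if k = 0 then 2 * (1 + a) else ε k) ≤ max (2 * (1 + a)) CP * ((Real.sqrt L)⁻¹) ^ k)
    ∧ ∀ (k : ℕ) (u : pidx L M (starP L M S) k → ℂ) (v : pidx L M (starP L M S) (k + 1) → ℂ),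
      ‖star v ⬝ᵥ ((JpR L M (starP L M S) k * regionDeltaLoc (lev L k) M 0 S
          - regionDeltaLoc (lev L (k + 1)) M 0 S * JpR L M (starP L M S) k) *ᵥ u)‖
        ≤ (if k = 0 then 2 * (1 + a) else ε k) * Real.sqrt (Ebud (lev L k) M a S u) * Real.sqrt (Ebud (lev L (k + 1)) M a S v) := by
  obtain ⟨h0, h1⟩ := hPW_rate_of_succ a ha.le (inv_nonneg.mpr (Real.sqrt_nonneg _)) hε1 hrate1
  exact ⟨h0, h1, hPW_of_succ M a S L ha.le hPW1⟩

/-- **KING's COMPRESSED INJECTED LAW OF THE FAITHFUL `Δ_a(Ω₀)` ON EVERY COORDINATE BOX MODULO THE RUNG-`≥ 1` GAFFNEY PAIRING** (`2 ≤ L`,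
`0 < a`, `0 < a′`): `‖G_{k+1}·JpR k − JpR k·G_k‖ ≤ CinjP·((√L)⁻¹)^k`. [folklore] -/
theorem hinjK_box_of_WPairing1 (hL : 2 ≤ L) (hbox : IsCoordBox M S) (ha : 0 < a) (ha' : 0 < a') {ε : ℕ → ℝ} {CP : ℝ}
    (hε1 : ∀ k, 1 ≤ k → 0 ≤ ε k) (hrate1 : ∀ k, 1 ≤ k → ε k ≤ CP * ((Real.sqrt L)⁻¹) ^ k)
    (hPW1 : ∀ (k : ℕ) (u : pidx L M (starP L M S) k → ℂ) (v : pidx L M (starP L M S) (k + 1) → ℂ), 1 ≤ k →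
      ‖star v ⬝ᵥ ((JpR L M (starP L M S) k * regionDeltaLoc (lev L k) M 0 S
          - regionDeltaLoc (lev L (k + 1)) M 0 S * JpR L M (starP L M S) k) *ᵥ u)‖
        ≤ ε k * Real.sqrt (Ebud (lev L k) M a S u) * Real.sqrt (Ebud (lev L (k + 1)) M a S v)) (k : ℕ) :
    ‖(regionDeltaA (lev L (k + 1)) M a a' S)⁻¹ * JpR L M (starP L M S) k
        - JpR L M (starP L M S) k * (regionDeltaA (lev L k) M a a' S)⁻¹‖ ≤ CinjP d L a a' CP * ((Real.sqrt L)⁻¹) ^ k := by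
  obtain ⟨hεW, hrate, hPW⟩ := hPW_splice L M S a ha hε1 hrate1 hPW1
  exact hinjK_box_of_WPairing L M a a' S hL hbox ha ha' le_rfl hεW hrate hPW k

/-- **THE RENORMALISED BOX STAR TOWER OF THE FAITHFUL `Δ_a(Ω₀)` AT RATE `(√L)⁻¹` MODULO THE RUNG-`≥ 1` GAFFNEY PAIRING.** [folklore] -/
theorem towerLimitRate_star_renorm_box_of_WPairing1 (hL : 2 ≤ L) (hbox : IsCoordBox M S) (ha : 0 < a) (ha' : 0 < a')
    {ε : ℕ → ℝ} {CP : ℝ} (hε1 : ∀ k, 1 ≤ k → 0 ≤ ε k) (hrate1 : ∀ k, 1 ≤ k → ε k ≤ CP * ((Real.sqrt L)⁻¹) ^ k)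
    (hPW1 : ∀ (k : ℕ) (u : pidx L M (starP L M S) k → ℂ) (v : pidx L M (starP L M S) (k + 1) → ℂ), 1 ≤ k →
      ‖star v ⬝ᵥ ((JpR L M (starP L M S) k * regionDeltaLoc (lev L k) M 0 S
          - regionDeltaLoc (lev L (k + 1)) M 0 S * JpR L M (starP L M S) k) *ᵥ u)‖
        ≤ ε k * Real.sqrt (Ebud (lev L k) M a S u) * Real.sqrt (Ebud (lev L (k + 1)) M a S v)) :
    TowerLimitRate (AnR L M (starP L M S)) ((L : ℝ) ^ d) (fun k => (regionDeltaA (lev L k) M a a' S)⁻¹)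
      (Cpert 0 (Real.sqrt (CgIbox d a' (cW1box d a a' 4) / 2 * (gamStar d a' (cW1box d a a' 4))⁻¹))
        (Real.sqrt L * CinjP d L a a' CP + (2 * (Real.sqrt L - 1)
          * Real.sqrt ((2 * (gamStar d a' (cW1box d a a' 4))⁻¹ + CgIbox d a' (cW1box d a a' 4)) * (gamStar d a' (cW1box d a a' 4))⁻¹))) 0 0 0)
      ((Real.sqrt L)⁻¹) := by
  obtain ⟨hεW, hrate, hPW⟩ := hPW_splice L M S a ha hε1 hrate1 hPW1
  exact towerLimitRate_star_renorm_box_of_WPairing L M a a' S hL hbox ha ha' le_rfl (inv_sqrt_lt_one L hL) hεW hrate hPW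

/-- **THE COMPRESSED (King) BOX STAR TOWER OF THE FAITHFUL `Δ_a(Ω₀)` AT RATE `(√L)⁻¹` MODULO THE RUNG-`≥ 1` GAFFNEY PAIRING** (gen 6's
zero-extension W2 in the linear class + `hinjK_box_of_WPairing1`). [folklore] -/
theorem towerLimitRate_star_box_of_WPairing1 (hL : 2 ≤ L) (hbox : IsCoordBox M S) (ha : 0 < a) (ha' : 0 < a')
    {ε : ℕ → ℝ} {CP : ℝ} (hε1 : ∀ k, 1 ≤ k → 0 ≤ ε k) (hrate1 : ∀ k, 1 ≤ k → ε k ≤ CP * ((Real.sqrt L)⁻¹) ^ k)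
    (hPW1 : ∀ (k : ℕ) (u : pidx L M (starP L M S) k → ℂ) (v : pidx L M (starP L M S) (k + 1) → ℂ), 1 ≤ k →
      ‖star v ⬝ᵥ ((JpR L M (starP L M S) k * regionDeltaLoc (lev L k) M 0 S
          - regionDeltaLoc (lev L (k + 1)) M 0 S * JpR L M (starP L M S) k) *ᵥ u)‖
        ≤ ε k * Real.sqrt (Ebud (lev L k) M a S u) * Real.sqrt (Ebud (lev L (k + 1)) M a S v)) :
    TowerLimitRate (QpR L M (starP L M S)) ((L : ℝ) ^ d) (fun k => (regionDeltaA (lev L k) M a a' S)⁻¹)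
      (Cpert 0 (2 * d * Real.sqrt ((CgLin0 d a a' + CgLin1 d a a') * L * (gamStar d a' (cW1box d a a' 4))⁻¹)) (CinjP d L a a' CP) 0
        ((gamStar d a' (cW1box d a a' 4))⁻¹ + Real.sqrt (d * ((CgLin0 d a a' + CgLin1 d a a') * L) * (gamStar d a' (cW1box d a a' 4))⁻¹))
        0) ((Real.sqrt L)⁻¹) :=
  towerLimitRate_star_box_of_compressed L M S a a' hL hbox ha ha' le_rfl (inv_sqrt_lt_one L hL)
    (hinjK_box_of_WPairing1 L M S a a' hL hbox ha ha' hε1 hrate1 hPW1)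

end Summit.QuantumFields.BalabanUV.T4Continuum.RegionBoxStarTowerSocket

end
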